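import Summits.Parity.GeneralizedHardyLittlewood.Theorems.PrimeLevelFamEdgeMomentsBeyondDiagonalDiagRungThree
import Summits.Parity.GeneralizedHardyLittlewood.Theorems.PrimeLevelFamEdgeMomentsBeyondDiagonalDiagRungTwoHolds
import Summits.Parity.GeneralizedHardyLittlewood.Theorems.PrimeLevelFamEdgeMomentsBeyondDiagonalDiagOrderOneThreeHolds
import Summits.Parity.GeneralizedHardyLittlewood.Theorems.PrimeLevelFamEdgeMomentsBeyondDiagonalDiagOrderThreeThreeOfR33
import Summits.Parity.GeneralizedHardyLittlewood.Theorems.PrimeLevelFamEdgeMomentsBeyondDiagonalDiagRemThreeThreeEstimate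
import HarnessLib

/-!
# Route `PrimeLevelFamEdge`, crux K_A `MomentsBeyondDiagonal` (stmt-Parity-20007), line «petersson_layers» v4, stub `stub_diag`:
# **RUNG `N = 3` OF `stub_diag` IS UNCONDITIONAL: the diagonal main term `diagPart q P Q Δ′` for EVERY admissible `P`, EVERY `Q`
# of degree `≤ 3` and every `Δ′ ∈ (1, 3/2]`, with error `O(q̂ log⁻³q̂)`** — and the order-`(3,3)` target unconditional

The three per-order targets of `…DiagRungThree.diagPart_asymp_of_natDegree_le_three_of_targets` are now theorems:
`(2,2)` = `…DiagRungTwoHolds.orderTwoTwo_target` (lineage famedge-1, (R₂₂)), `(1,3)` = `…DiagOrderOneThreeHolds.orderOneThree_target`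
((R₁₃)), and `(3,3)` = `…DiagOrderThreeThreeOfR33.orderThreeThree_target_of_remainder` ((M4P2) engine `…DiagDecorM4P2Family`, this
lineage) fed with `…DiagRemThreeThreeEstimate.remainder_estimate₃₃` ((R₃₃), lineage famedge-1 g14, p835797):

* `orderThreeThree_target` — **the order-`(3,3)` target, unconditional** (window `(1,Δ]`, `Δ ≤ 3/2`);
* `diagPart_asymp_of_natDegree_le_three` — **RUNG 3**: `‖diagPart q P Q Δ′ − 2ζ(2)²q̂/(Δ′²ℓ²)·(Q₀²·secondMomentForm Δ′ P 1 + 2Q₁²τ₁₁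
  + 4Q₀Q₂τ₀₂ + 2Q₂²τ₂₂ + 4Q₁Q₃τ₁₃ + 2Q₃²τ₃₃)‖ ≤ C q̂ ℓ⁻³` with the five closed-form level-free functionals displayed
  (`τ₂₂ = Δ′⁴𝔎₂₂/(2(π²/6)²)`, `τ₁₃ = Δ′⁴𝔎₁₃/(2(π²/6)²)`, `τ₃₃ = Δ′⁶𝔎₃₃/(2(π²/6)²)`,
  `𝔎₂₂ = (π²/6)²(Φ₅/160 − Ψ₃/24 + (3/16)Ξ₁)`, `𝔎₁₃ = (π²/6)²(Φ₅/160 − (3/16)Ξ₁)`, `𝔎₃₃ = (π²/6)²(Φ₇/896 − (3/320)Ψ₅ + (3/64)Ξ₃)`).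

Rung currency: the diagonal evaluation of `stub_diag` now holds for all `Q` of degree `≤ 3` (rungs 1, 2, 3); `stub_diag` itself (every
`Q`) needs every rung / the generic order `(i,j)`; `stub_rung/core/band` (the off-diagonal heart, famE-02) are untouched. Def-free;
theorems only. Helper `--supports stmt-Parity-20007`; closes nothing; K_A, K_B and the Parity summit are NOT proved; nothing about
Landau–Siegel zeros.

## References
* E. Kowalski, P. Michel, J. VanderKam, J. reine angew. Math. 526 (2000), (23)–(28) pp. 13–15, Prop. 5.1 (31) p. 18.
  [cite: KowalskiMichelVanderKam2000, (23)–(28) pp. 13–15 — derivation (diagonal main term, Q of degree ≤ 3)]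
-/

noncomputable section

open scoped Real ArithmeticFunction.Moebius
open Complex MeasureTheory Polynomial Finset ArithmeticFunction Set intervalIntegral
open Literature.NumberTheory.LFunctions Literature.NumberTheory.LFunctions.KMV2000

namespace Summit.Parity.GeneralizedHardyLittlewood.Theorems.MomentsBeyondDiagonal.DiagCorner

open Summit.Parity.GeneralizedHardyLittlewood.Theorems.PrimeLevelFamEdgeIdeaDeltas.PeterssonLayers
  (diagPart HasShape SubOf SubDiag)
open Summit.Parity.GeneralizedHardyLittlewood.Theorems.MomentsBeyondDiagonal.DiagKernel (orderThreeThree_target_of_remainder)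
open Summit.Parity.GeneralizedHardyLittlewood.Theorems.MomentsBeyondDiagonal.DiagLines
  (diagPart_asymp_of_natDegree_le_three_of_targets)

set_option maxHeartbeats 1600000 in
set_option maxRecDepth 8192 in
-- large statement
/-- **THE ORDER-`(3,3)` TARGET OF `stub_diag`, UNCONDITIONAL** (window `(1, Δ]`, any `Δ ≤ 3/2`): (M4P2) by
`…DiagDecorM4P2Family`, (R₃₃) by `…DiagRemThreeThreeEstimate.remainder_estimate₃₃`.
[cite: KowalskiMichelVanderKam2000, (23)–(28) and Prop. 5.1 — derivation (order-(3,3) piece of the diagonal, general Q)] -/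
theorem orderThreeThree_target {Δ : ℝ} (hΔ : Δ ≤ 3 / 2) :
    ∀ P : ℝ[X], KMV2000.Admissible P → ∀ Δ' : ℝ, 1 < Δ' → Δ' ≤ Δ →
      ∃ C : ℝ, ∃ q₀ : ℕ, ∀ (q : ℕ) [NeZero q], q₀ ≤ q →
        |(Real.log (qhat q))⁻¹ ^ (3 + 3) * qhat q *
          (∑ c ∈ Icc 1 ⌊qhat q ^ Δ'⌋₊, ∑ g ∈ Icc 1 (⌊qhat q ^ Δ'⌋₊ / c), (μ g : ℝ) * c *
        ∑ k₁ ∈ Icc 1 (⌊qhat q ^ Δ'⌋₊ / (c * g)), ∑ k₂ ∈ Icc 1 (⌊qhat q ^ Δ'⌋₊ / (c * g)),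
          ((μ (c * g * k₁) : ℝ) * ((psi (c * g * k₁))⁻¹ *
              P.eval (Real.log (qhat q ^ Δ' / ((c * g * k₁ : ℕ) : ℝ)) / Real.log (qhat q ^ Δ'))) / ((c * g * k₁ : ℕ) : ℝ)) *
            ((μ (c * g * k₂) : ℝ) * ((psi (c * g * k₂))⁻¹ *
              P.eval (Real.log (qhat q ^ Δ' / ((c * g * k₂ : ℕ) : ℝ)) / Real.log (qhat q ^ Δ'))) / ((c * g * k₂ : ℕ) : ℝ)) *
            (∑ d ∈ k₁.divisors, ∑ e ∈ k₂.divisors,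
              ∫ u₁ in Ioi (0 : ℝ),
                (Real.log (qhat q / ((k₁ / d * (g * e) : ℕ) : ℝ)) + Real.log u₁) ^ 3 *
                ∫ u₂ in Ioi ((((k₁ / d * (g * e) * (g * d * (k₂ / e)) : ℕ) : ℝ) / qhat q ^ 2) / u₁),
                  Real.exp (-(u₁ + u₂)) / (1 - Real.exp (-(u₁ + u₂))) ^ 2 *
                  (Real.log (qhat q / ((g * d * (k₂ / e) : ℕ) : ℝ)) + Real.log u₂) ^ 3)) -
          2 * (π ^ 2 / 6) ^ 2 * (qhat q / (Δ' ^ 2 * Real.log (qhat q) ^ 2)) *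
            (Δ' ^ 2 * (Δ' ^ 4 * ((π ^ 2 / 6) ^ 2 * ((1 / 896) * (∑ j ∈ Finset.range (7 + 1), ∑ i ∈ Finset.range (j + 1),
            ((7 : ℕ).choose j : ℝ) * (j.choose i : ℝ) * 2 ^ (7 - j) *
              ∫ u in (0 : ℝ)..1, (((Polynomial.C (1 / Δ') - X) ^ (7 - j) * derivative (derivative (X ^ i * P))) *
                derivative (derivative (X ^ (j - i) * P))).eval u) +
          (-3 / 320) * (∑ j ∈ Finset.range (5 + 1), ∑ i ∈ Finset.range (j + 1),
            ((5 : ℕ).choose j : ℝ) * (j.choose i : ℝ) * 2 ^ (5 - j) *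
              ∫ u in (0 : ℝ)..1, (((Polynomial.C (1 / Δ') - X) ^ (5 - j) * (-(2 : ℝ) • (X ^ i * P))) *
                derivative (derivative (X ^ (j - i) * P))).eval u) +
          (3 / 64) * (∑ j ∈ Finset.range (3 + 1), ∑ i ∈ Finset.range (j + 1),
            ((3 : ℕ).choose j : ℝ) * (j.choose i : ℝ) * 2 ^ (3 - j) *
              ∫ u in (0 : ℝ)..1, (((Polynomial.C (1 / Δ') - X) ^ (3 - j) * (-(2 : ℝ) • (X ^ i * P))) *
                (-(2 : ℝ) • (X ^ (j - i) * P))).eval u)))) / (2 * (π ^ 2 / 6) ^ 2))| ≤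
          C * qhat q * (Real.log (qhat q))⁻¹ ^ 3 := by
  refine orderThreeThree_target_of_remainder (Δ := Δ) ?_
  obtain ⟨E₀₀, E₀₁, E₀₂, E₀₃, E₁₀, E₁₁, E₁₂, E₁₃, E₂₀, E₂₁, E₂₂, E₂₃, E₃₀, E₃₁, E₃₂, E₃₃, μ₂, μ₄, μ₆, h⟩ :=
    remainder_estimate₃₃
  exact ⟨E₀₀, E₀₁, E₀₂, E₀₃, E₁₀, E₁₁, E₁₂, E₁₃, E₂₀, E₂₁, E₂₂, E₂₃, E₃₀, E₃₁, E₃₂, E₃₃, μ₂, μ₄, μ₆,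
    fun P hP Δ' h1 h2 ↦ h P hP Δ' h1 (h2.trans hΔ)⟩

set_option maxHeartbeats 1600000 in
set_option maxRecDepth 8192 in
-- large statement (five closed-form functionals); three large instantiations of the rung-3 frame
/-- **RUNG `N = 3` OF `stub_diag`, UNCONDITIONAL**: the diagonal main term for every admissible `P`, every `Q` of degree `≤ 3`
and every `Δ′ ∈ (1, 3/2]` (see the module docstring).
[cite: KowalskiMichelVanderKam2000, (23)–(28) pp. 13–15, Prop. 5.1 (31) — derivation (diagonal main term, Q of degree ≤ 3)] -/
theorem diagPart_asymp_of_natDegree_le_three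
    {P Q : ℝ[X]} (hP : KMV2000.Admissible P) (hQ : Q.natDegree ≤ 3) {Δ' : ℝ} (h1 : 1 < Δ') (h32 : Δ' ≤ 3 / 2) :
    ∃ C : ℝ, ∃ q₀ : ℕ, ∀ (q : ℕ) [NeZero q], q₀ ≤ q →
      ‖diagPart q P Q Δ' -
          ((2 * riemannZeta 2 ^ 2 *
              ((qhat q / (Δ' ^ 2 * Real.log (qhat q) ^ 2) : ℝ) : ℂ)) *
            ((Q.coeff 0 ^ 2 * KMV2000.secondMomentForm Δ' P 1 +
              2 * Q.coeff 1 ^ 2 *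
                (Δ' ^ 2 * ((π ^ 2 / 6) ^ 2 *
              ((∑ j ∈ Finset.range (3 + 1), ∑ i ∈ Finset.range (j + 1),
                  ((3 : ℕ).choose j : ℝ) * (j.choose i : ℝ) * 2 ^ (3 - j) *
                    ∫ u in (0 : ℝ)..1, (((Polynomial.C (1 / Δ') - X) ^ (3 - j) *
                      derivative (derivative (X ^ i * P))) * derivative (derivative (X ^ (j - i) * P))).eval u) / 24 -
                (∑ j ∈ Finset.range (1 + 1), ∑ i ∈ Finset.range (j + 1),
                  ((1 : ℕ).choose j : ℝ) * (j.choose i : ℝ) * 2 ^ (1 - j) *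
                    ∫ u in (0 : ℝ)..1, (((Polynomial.C (1 / Δ') - X) ^ (1 - j) * (-(2 : ℝ) • (X ^ i * P))) *
                      derivative (derivative (X ^ (j - i) * P))).eval u) / 4)) / (2 * (π ^ 2 / 6) ^ 2)) +
              4 * (Q.coeff 0 * Q.coeff 2) *
                (Δ' ^ 2 * ((π ^ 2 / 6) ^ 2 *
              ((∑ j ∈ Finset.range (3 + 1), ∑ i ∈ Finset.range (j + 1),
                  ((3 : ℕ).choose j : ℝ) * (j.choose i : ℝ) * 2 ^ (3 - j) *
                    ∫ u in (0 : ℝ)..1, (((Polynomial.C (1 / Δ') - X) ^ (3 - j) *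
                      derivative (derivative (X ^ i * P))) * derivative (derivative (X ^ (j - i) * P))).eval u) / 24 +
                (∑ j ∈ Finset.range (1 + 1), ∑ i ∈ Finset.range (j + 1),
                  ((1 : ℕ).choose j : ℝ) * (j.choose i : ℝ) * 2 ^ (1 - j) *
                    ∫ u in (0 : ℝ)..1, (((Polynomial.C (1 / Δ') - X) ^ (1 - j) * (-(2 : ℝ) • (X ^ i * P))) *
                      derivative (derivative (X ^ (j - i) * P))).eval u) / 4)) / (2 * (π ^ 2 / 6) ^ 2)) +
              2 * Q.coeff 2 ^ 2 *
                (Δ' ^ 2 * (Δ' ^ 2 * ((π ^ 2 / 6) ^ 2 * ((∑ j ∈ Finset.range (5 + 1), ∑ i ∈ Finset.range (j + 1),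
            ((5 : ℕ).choose j : ℝ) * (j.choose i : ℝ) * 2 ^ (5 - j) *
              ∫ u in (0 : ℝ)..1, (((Polynomial.C (1 / Δ') - X) ^ (5 - j) * derivative (derivative (X ^ i * P))) *
                derivative (derivative (X ^ (j - i) * P))).eval u) / 160 -
          (∑ j ∈ Finset.range (3 + 1), ∑ i ∈ Finset.range (j + 1),
            ((3 : ℕ).choose j : ℝ) * (j.choose i : ℝ) * 2 ^ (3 - j) *
              ∫ u in (0 : ℝ)..1, (((Polynomial.C (1 / Δ') - X) ^ (3 - j) * (-(2 : ℝ) • (X ^ i * P))) *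
                derivative (derivative (X ^ (j - i) * P))).eval u) / 24 +
          3 / 16 * (∑ j ∈ Finset.range (1 + 1), ∑ i ∈ Finset.range (j + 1),
            ((1 : ℕ).choose j : ℝ) * (j.choose i : ℝ) * 2 ^ (1 - j) *
              ∫ u in (0 : ℝ)..1, (((Polynomial.C (1 / Δ') - X) ^ (1 - j) * (-(2 : ℝ) • (X ^ i * P))) *
                (-(2 : ℝ) • (X ^ (j - i) * P))).eval u)))) / (2 * (π ^ 2 / 6) ^ 2)) +
              4 * (Q.coeff 1 * Q.coeff 3) *
                (Δ' ^ 2 * (Δ' ^ 2 * ((π ^ 2 / 6) ^ 2 * ((∑ j ∈ Finset.range (5 + 1), ∑ i ∈ Finset.range (j + 1),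
            ((5 : ℕ).choose j : ℝ) * (j.choose i : ℝ) * 2 ^ (5 - j) *
              ∫ u in (0 : ℝ)..1, (((Polynomial.C (1 / Δ') - X) ^ (5 - j) * derivative (derivative (X ^ i * P))) *
                derivative (derivative (X ^ (j - i) * P))).eval u) / 160 -
          3 / 16 * (∑ j ∈ Finset.range (1 + 1), ∑ i ∈ Finset.range (j + 1),
            ((1 : ℕ).choose j : ℝ) * (j.choose i : ℝ) * 2 ^ (1 - j) *
              ∫ u in (0 : ℝ)..1, (((Polynomial.C (1 / Δ') - X) ^ (1 - j) * (-(2 : ℝ) • (X ^ i * P))) *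
                (-(2 : ℝ) • (X ^ (j - i) * P))).eval u)))) / (2 * (π ^ 2 / 6) ^ 2)) +
              2 * Q.coeff 3 ^ 2 *
                (Δ' ^ 2 * (Δ' ^ 4 * ((π ^ 2 / 6) ^ 2 * ((1 / 896) * (∑ j ∈ Finset.range (7 + 1), ∑ i ∈ Finset.range (j + 1),
            ((7 : ℕ).choose j : ℝ) * (j.choose i : ℝ) * 2 ^ (7 - j) *
              ∫ u in (0 : ℝ)..1, (((Polynomial.C (1 / Δ') - X) ^ (7 - j) * derivative (derivative (X ^ i * P))) *
                derivative (derivative (X ^ (j - i) * P))).eval u) +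
          (-3 / 320) * (∑ j ∈ Finset.range (5 + 1), ∑ i ∈ Finset.range (j + 1),
            ((5 : ℕ).choose j : ℝ) * (j.choose i : ℝ) * 2 ^ (5 - j) *
              ∫ u in (0 : ℝ)..1, (((Polynomial.C (1 / Δ') - X) ^ (5 - j) * (-(2 : ℝ) • (X ^ i * P))) *
                derivative (derivative (X ^ (j - i) * P))).eval u) +
          (3 / 64) * (∑ j ∈ Finset.range (3 + 1), ∑ i ∈ Finset.range (j + 1),
            ((3 : ℕ).choose j : ℝ) * (j.choose i : ℝ) * 2 ^ (3 - j) *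
              ∫ u in (0 : ℝ)..1, (((Polynomial.C (1 / Δ') - X) ^ (3 - j) * (-(2 : ℝ) • (X ^ i * P))) *
                (-(2 : ℝ) • (X ^ (j - i) * P))).eval u)))) / (2 * (π ^ 2 / 6) ^ 2)) : ℝ) : ℂ))‖ ≤
        C * qhat q * (Real.log (qhat q))⁻¹ ^ 3 := by
  have h := diagPart_asymp_of_natDegree_le_three_of_targets (Δ := 3 / 2) le_rfl
    (fun (lam : ℝ) (P : ℝ[X]) ↦ ((π ^ 2 / 6) ^ 2 * ((∑ j ∈ Finset.range (5 + 1), ∑ i ∈ Finset.range (j + 1),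
            ((5 : ℕ).choose j : ℝ) * (j.choose i : ℝ) * 2 ^ (5 - j) *
              ∫ u in (0 : ℝ)..1, (((Polynomial.C lam - X) ^ (5 - j) * derivative (derivative (X ^ i * P))) *
                derivative (derivative (X ^ (j - i) * P))).eval u) / 160 -
          (∑ j ∈ Finset.range (3 + 1), ∑ i ∈ Finset.range (j + 1),
            ((3 : ℕ).choose j : ℝ) * (j.choose i : ℝ) * 2 ^ (3 - j) *
              ∫ u in (0 : ℝ)..1, (((Polynomial.C lam - X) ^ (3 - j) * (-(2 : ℝ) • (X ^ i * P))) *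
                derivative (derivative (X ^ (j - i) * P))).eval u) / 24 +
          3 / 16 * (∑ j ∈ Finset.range (1 + 1), ∑ i ∈ Finset.range (j + 1),
            ((1 : ℕ).choose j : ℝ) * (j.choose i : ℝ) * 2 ^ (1 - j) *
              ∫ u in (0 : ℝ)..1, (((Polynomial.C lam - X) ^ (1 - j) * (-(2 : ℝ) • (X ^ i * P))) *
                (-(2 : ℝ) • (X ^ (j - i) * P))).eval u))))
    (fun (lam : ℝ) (P : ℝ[X]) ↦ ((π ^ 2 / 6) ^ 2 * ((∑ j ∈ Finset.range (5 + 1), ∑ i ∈ Finset.range (j + 1),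
            ((5 : ℕ).choose j : ℝ) * (j.choose i : ℝ) * 2 ^ (5 - j) *
              ∫ u in (0 : ℝ)..1, (((Polynomial.C lam - X) ^ (5 - j) * derivative (derivative (X ^ i * P))) *
                derivative (derivative (X ^ (j - i) * P))).eval u) / 160 -
          3 / 16 * (∑ j ∈ Finset.range (1 + 1), ∑ i ∈ Finset.range (j + 1),
            ((1 : ℕ).choose j : ℝ) * (j.choose i : ℝ) * 2 ^ (1 - j) *
              ∫ u in (0 : ℝ)..1, (((Polynomial.C lam - X) ^ (1 - j) * (-(2 : ℝ) • (X ^ i * P))) *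
                (-(2 : ℝ) • (X ^ (j - i) * P))).eval u))))
    (fun (lam : ℝ) (P : ℝ[X]) ↦ ((π ^ 2 / 6) ^ 2 * ((1 / 896) * (∑ j ∈ Finset.range (7 + 1), ∑ i ∈ Finset.range (j + 1),
            ((7 : ℕ).choose j : ℝ) * (j.choose i : ℝ) * 2 ^ (7 - j) *
              ∫ u in (0 : ℝ)..1, (((Polynomial.C lam - X) ^ (7 - j) * derivative (derivative (X ^ i * P))) *
                derivative (derivative (X ^ (j - i) * P))).eval u) +
          (-3 / 320) * (∑ j ∈ Finset.range (5 + 1), ∑ i ∈ Finset.range (j + 1),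
            ((5 : ℕ).choose j : ℝ) * (j.choose i : ℝ) * 2 ^ (5 - j) *
              ∫ u in (0 : ℝ)..1, (((Polynomial.C lam - X) ^ (5 - j) * (-(2 : ℝ) • (X ^ i * P))) *
                derivative (derivative (X ^ (j - i) * P))).eval u) +
          (3 / 64) * (∑ j ∈ Finset.range (3 + 1), ∑ i ∈ Finset.range (j + 1),
            ((3 : ℕ).choose j : ℝ) * (j.choose i : ℝ) * 2 ^ (3 - j) *
              ∫ u in (0 : ℝ)..1, (((Polynomial.C lam - X) ^ (3 - j) * (-(2 : ℝ) • (X ^ i * P))) *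
                (-(2 : ℝ) • (X ^ (j - i) * P))).eval u))))
    (by convert orderTwoTwo_target (Δ := 3 / 2) le_rfl using 12)
    (by convert orderOneThree_target (Δ := 3 / 2) le_rfl using 12)
    (by convert orderThreeThree_target (Δ := 3 / 2) le_rfl using 12) hP hQ h1 h32
  beta_reduce at h
  convert h using 12

end Summit.Parity.GeneralizedHardyLittlewood.Theorems.MomentsBeyondDiagonal.DiagCorner

end
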